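import Summits.BirchSwinnertonDyer.Rank1Residual.Additive.KatoDescentClosedBindersContraBridge
import Summits.BirchSwinnertonDyer.BirchSwinnertonDyer.Theorems.CongruentShaFreeCutKatoDescentRealisable
import Summits.BirchSwinnertonDyer.BirchSwinnertonDyer.Theorems.CyclotomicUntwistRohrlichAtLevel
import Literature.NumberTheory.EllipticCurves.Kato2004.AdmissibleZetaClassNonvanishingProofs
import HarnessLib

set_option autoImplicit false

/-!
# The Kato descent datum at the PRINT-EXACT (contragredient) closed binders is REALISABLE from Kato's two
# construction facts and the finiteness of `W(ℚ_{p,∞})[p^∞]` — stub 4 `stub_realizableOfKMCFine` of the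
# Kato–Perrin-Riou skeletons v4 (cruxes stmt-BirchSwinnertonDyer-19945 `…/Lines/kato_perrin_riou_zp.lean`,
# stmt-BirchSwinnertonDyer-19223 `…/Lines/kato_perrin_riou_istar.lean`) REDUCED to named, displayed inputs
# (seat `bsd-cm-prr-ty1` g6, cell `bsd-cm`; theorems only: no definition, no named fact, no instance, no `sorry`)

WHAT. Stub 4 of both registered skeletons (planner D414) is the hypothesis schema
`TorsionFree.RealizableOfKMC IsKatoZetaDescentDatumOfContra KatoMainConjectureFineContra`
(`KatoDescentTorsionFreeReadings.lean` §1, reading 3♭): for every elliptic, globally minimal `W/ℚ` and prime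
`p ≠ 2` with `W` additive and potentially good at `p` and `p ∤ #W(ℚ)_tors`, Kato's Main Conjecture 12.10 in the
print-exact fine-Selmer form `KatoMainConjectureFineContra W p` (`KatoDescentClosedBindersContra.lean`, p628155)
yields a `D : KatoDescentDatum p` with `IsKatoZetaDescentDatumOfContra W p D`. This file proves that schema FROM:

* `Kato2004.thm12_4` (bsd-smallim's named fact; Kato Thm. 12.4 (2): `𝐇¹_Γ(T_pW)` is finitely generated, torsion
  free of `Λ`-rank one) [cite: Kato2004Asterisque, Thm. 12.4 (p. 221)];
* `Kato2004.exists_iwasawaH2Data_fineSelmerDual_embedding` (this seat's named fact p624791; Kato (14.9.1) +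
  (12.2.3) + (17.13.1): for `p` odd, `κ` cyclotomic and `W(ℚ_{p,∞})[p^∞]` finite, Kato's `𝐇²_Γ(T_pW)` contains
  `X₀(E/ℚ_∞)` with finite cokernel) [cite: Kato2004Asterisque, (14.9.1) (p. 239), §12.2 (12.2.3) (p. 220), §17.13 (17.13.1) (p. 279)],
  consumed through `ContraBridge.exists_iwasawaH2Data_lengthAt_eq_forall_fineSelmerDualData_inv` (p629405: the
  (H2ᶜ) lengths against EVERY dual fine Selmer datum of key `γ⁻¹`);
* the finiteness of `W(ℚ_{p,∞})[p^∞] = (W(ℚ̄)[p^∞])^{ker κ ⊓ D_v}` for the cyclotomic `κ` and the place `v` of `ℚ`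
  at `p` — DISPLAYED, either per pair (§2) or as the schema «`0 ≤ v_p(j W)` ⟹ finite» (§3), which is Imai's
  theorem [Imai, Proc. Japan Acad. 51 (1975), Theorem (p. 12): for an abelian variety `A` with good reduction over a
  finite `K/ℚ_p`, `A(K(μ_{p^∞}))_tors` is finite] applied over a finite extension of `ℚ_p` where `W` acquires good
  reduction (`0 ≤ v_p(j W)` ⟺ potentially good reduction [cite: SilvermanAEC2009, Prop. VII.5.5]); this bridge is NOT
  proved here and NOT minted as a fact (net debt 0) [cite: Imai1975, Theorem (p. 12)];

and NOTHING ELSE: the zeta class is the `∃`-conjunct of `KatoMainConjectureFineContra W p` (an ADMISSIBLE zeta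
class `z₀ ∈ 𝐇¹_Γ`, `Kato2004.IsAdmissibleZetaClass`), and its non-vanishing `z₀ ≠ 0` — Kato's proof of Thm. 12.5 (1)
from Thm. 12.4 via Rohrlich — is the TREE THEOREM `Kato2004.IsAdmissibleZetaClass.ne_zero_of_rohrlich` fed with the
tree's proof of Rohrlich's theorem for `p`-power conductors at any level,
`PSRohrlichAtLevel.rohrlich_primePow_of_isNewformOf` [cite: RohrlichInventiones1984, Theorem (p. 409)]
[cite: Kato2004Asterisque, Thm. 12.5 (1) and proof (pp. 221–222)]. The hypotheses `Addv W p` and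
`¬ p ∣ W.torsionOrder` of the schema are not used (recorded, not hidden: the schema is proved as displayed).

## Contents (namespace `Summit.BirchSwinnertonDyer.Rank1Residual.Additive.ContraRealizable`)

* §1 `exists_isKatoZetaDescentDatumOfContra_of_packages` — the GENERIC pin: from `I : IwasawaH1Data W p κ γ`
  (`κ` cyclotomic) finitely generated torsion free of rank one, `J : IwasawaH2Data W p κ γ I` whose `H2` has the
  height-one lengths of every `Y : W.FineSelmerDualData κ γ⁻¹`, and an admissible `z₀ ≠ 0`, the datum
  `D := (I.H, z₀, J.H2, J.A, J.ι, J.π)` with `IsKatoZetaDescentDatumOfContra W p D` — cn100's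
  `CongruentShaFreeCutKatoDescentRealisable.exists_pin_of_packages` redone with the identity pin kept VISIBLE
  (`P.I = I`, `P.eH = refl`, `P.J = J`), so that `isKatoZetaDescentDatumOfContra_of_pin` applies.
* §2 `exists_isKatoZetaDescentDatumOfContra_of_kmcFineContra` — per pair `(W, p)`: the two named facts, the local
  finiteness for the cyclotomic `κ` at `v | p`, and `KatoMainConjectureFineContra W p` give a realised datum.
* §3 `realizableOfKMC_contra_of_thm12_4_of_h2Embedding_of_localFinite` — STUB 4 BY NAME:
  `Kato2004.thm12_4 → Kato2004.exists_iwasawaH2Data_fineSelmerDual_embedding → (Imai schema) →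
  TorsionFree.RealizableOfKMC IsKatoZetaDescentDatumOfContra KatoMainConjectureFineContra`.

RESIDUAL OF STUB 4 AFTER THIS FILE (planner D417 (i)) = exactly the three displayed inputs of §3:
{`Kato2004.thm12_4` (named fact, bsd-smallim, unproved), `Kato2004.exists_iwasawaH2Data_fineSelmerDual_embedding`
(named fact p624791, unproved), the Imai local-finiteness schema `hImai` (displayed; Imai 1975 + potential good
reduction, not in the tree)} — a prover closes `stub_realizableOfKMCFine` of either skeleton by
`exact ContraRealizable.realizableOfKMC_contra_of_thm12_4_of_h2Embedding_of_localFinite h₁ h₂ h₃` the day terms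
`h₁ h₂ h₃` of those three types exist (the conclusion of §3 is literally the stub's type, no further binder).

HONEST LABEL: every statement is a CONDITIONAL reduction on displayed hypotheses (two unproved named Literature
facts, Imai's theorem as a schema, and — inside the schema — Kato's Conjecture 12.10); no stub or item is closed,
nothing is registered, nothing is asserted on 19945 / 19223; Kato's Main Conjecture is not proved; BSD is not
proved for any curve. `Summits/…/Theorems/` being prover-only (D-0016), the file lives next to the binders it serves.
-/

noncomputable section

open scoped Classical NumberField

open WeierstrassCurve Field IsDedekindDomain Literature.NumberTheory.EllipticCurves
  Literature.NumberTheory.EllipticCurves.Kato2004 Literature.NumberTheory.EllipticCurves.IwasawaAlgebra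
  Literature.NumberTheory.GaloisRepresentations
open Summit.BirchSwinnertonDyer.BirchSwinnertonDyer.Theorems.CongruentShaFreeCutKatoDescentDatumOfH2
open Summit.BirchSwinnertonDyer.BirchSwinnertonDyer.Theorems.CongruentShaFreeCutKatoDescentRealisable
  (noZeroSMulDivisors_of_isTorsionFree)
open Summit.BirchSwinnertonDyer.BirchSwinnertonDyer.Theorems.PSRohrlichAtLevel (rohrlich_primePow_of_isNewformOf)

namespace Summit.BirchSwinnertonDyer.Rank1Residual.Additive.ContraRealizable

/-! ## §1 The generic pin at the contragredient closed binders -/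

/-- **A realised contragredient descent datum ON a pair of packages.** For `κ` cyclotomic with topological
generator `γ`, `I : IwasawaH1Data W p κ γ` with `I.H` finitely generated, torsion free of rank one (the conclusions
of Kato's Thm. 12.4 (2)), a descent package `J : IwasawaH2Data W p κ γ I` whose `H2` has, at every height-one prime
of `Λ`, the lengths of every dual fine Selmer datum of key `γ⁻¹` (the (H2ᶜ) clause), and an ADMISSIBLE zeta class
`z₀ ≠ 0` of `I`, the datum `D := (I.H, z₀, J.H2, J.A, J.ι, J.π)` satisfies `IsKatoZetaDescentDatumOfContra W p D`
(identity pin). [cite: Kato2004Asterisque, Thm. 12.4 (p. 221), §14.14 (14.14.1) (p. 243), Conj. 12.10 (p. 224)] -/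
theorem exists_isKatoZetaDescentDatumOfContra_of_packages (W : WeierstrassCurve ℚ) [W.IsElliptic]
    [W.IsGloballyMinimal] (p : ℕ) [Fact p.Prime] [ContinuousSMul ℤ_[p] (W.tateModule p)]
    {κ : ZpExtension ℚ p} {γ : absoluteGaloisGroup ℚ} (hκ : κ.IsCyclotomic) (hγ : κ.IsTopGenerator γ)
    (I : IwasawaH1Data W p κ γ) (hfin : Module.Finite (IwasawaAlgebra p) I.H)
    (htf : Module.IsTorsionFree (IwasawaAlgebra p) I.H) (hrk : Module.rank (IwasawaAlgebra p) I.H = 1)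
    (J : IwasawaH2Data W p κ γ I)
    (hJ : ∀ (Y : W.FineSelmerDualData κ γ⁻¹) (𝔮 : PrimeSpectrum (IwasawaAlgebra p)), 𝔮.asIdeal.height = 1 →
      Module.lengthAt (IwasawaAlgebra p) J.H2 𝔮 = Module.lengthAt (IwasawaAlgebra p) Y.X 𝔮)
    {z₀ : I.H} (hz₀ : z₀ ≠ 0) (hadm : IsAdmissibleZetaClass W p κ hκ I z₀) :
    ∃ D : KatoDescentDatum p, IsKatoZetaDescentDatumOfContra W p D ∧ D.H = I.H := by
  haveI := hfin
  haveI := htf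
  haveI : NoZeroSMulDivisors (IwasawaAlgebra p) I.H := noZeroSMulDivisors_of_isTorsionFree I.H
  haveI := J.finite_H2
  have hfr : Module.finrank (IwasawaAlgebra p) I.H = 1 :=
    Module.finrank_eq_of_rank_eq (by rw [hrk]; rfl)
  have htor : Module.IsTorsion (IwasawaAlgebra p) (I.H ⧸ (IwasawaAlgebra p) ∙ z₀) :=
    IwasawaAlgebra.isTorsion_quotient_span_singleton_of_finrank_eq_one p hfr hz₀
  let D : KatoDescentDatum p :=
    { H := I.H, z := z₀, z_ne_zero := hz₀, isTorsion_quotient := htor,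
      H2 := J.H2, isTorsion_H2 := J.isTorsion_H2, A := J.A,
      ι := J.ι, π := J.π, ι_injective := J.ι_injective, π_surjective := J.π_surjective,
      exact_ι_π := J.exact_ι_π }
  let P : KatoDescentDatumPinH2 W p D :=
    { κ := κ, isCyclotomic := hκ, γ := γ, isTopGenerator := hγ, I := I, J := J,
      eH := LinearEquiv.refl _ _, eH2 := LinearEquiv.refl _ _, eA := LinearEquiv.refl _ _,
      eA_ι := fun _ ↦ rfl, eH2_π := fun _ ↦ rfl }
  exact ⟨D, isKatoZetaDescentDatumOfContra_of_pin P hadm hJ, rfl⟩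

/-! ## §2 Per pair: the realised datum from the two construction facts, local finiteness and `KMC` -/

/-- **Per pair `(W, p)`, `p ≠ 2`: a realised contragredient Kato descent datum from Kato's two construction facts,
the finiteness of `W(ℚ_{p,∞})[p^∞]`, and `KatoMainConjectureFineContra W p`.** The zeta class is the `∃`-conjunct of
`KatoMainConjectureFineContra W p`; it is non-zero by Kato's Thm. 12.5 (1) argument — the tree theorem
`IsAdmissibleZetaClass.ne_zero_of_rohrlich` with Rohrlich's theorem `PSRohrlichAtLevel.rohrlich_primePow_of_isNewformOf`;
`𝐇¹_Γ` is torsion free of rank one by `Kato2004.thm12_4`; the package `J` with the (H2ᶜ) lengths is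
`ContraBridge.exists_iwasawaH2Data_lengthAt_eq_forall_fineSelmerDualData_inv` (fact
`Kato2004.exists_iwasawaH2Data_fineSelmerDual_embedding`). The local finiteness is displayed for every cyclotomic `κ`
and every place `v` of `ℚ` at `p` (hypothesis `hloc`). CONDITIONAL; nothing asserted about 12.10 or BSD.
[cite: Kato2004Asterisque, Thm. 12.4 (p. 221), Thm. 12.5 (1) and proof (pp. 221–222), Conj. 12.10 (p. 224), (14.9.1) (p. 239), §14.14 (14.14.1) (p. 243)]
[cite: RohrlichInventiones1984, Theorem (p. 409)] -/
theorem exists_isKatoZetaDescentDatumOfContra_of_kmcFineContra (h12 : Kato2004.thm12_4)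
    (hH2 : Kato2004.exists_iwasawaH2Data_fineSelmerDual_embedding)
    (W : WeierstrassCurve ℚ) [W.IsElliptic] [W.IsGloballyMinimal] (p : ℕ) [Fact p.Prime] (hp : p ≠ 2)
    (hloc : ∀ (κ : ZpExtension ℚ p) (v : HeightOneSpectrum (𝓞 ℚ)), κ.IsCyclotomic →
      ((Rat.HeightOneSpectrum.primesEquiv v : Nat.Primes) : ℕ) = p →
      Finite (FixedPoints.addSubgroup ↥(κ.kerSubgroup ⊓ GreenbergSelmer.decomp v) (W.geomPrimaryTorsion p)))
    (hKMC : KatoMainConjectureFineContra W p) :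
    ∃ D : KatoDescentDatum p, IsKatoZetaDescentDatumOfContra W p D := by
  letI : ContinuousSMul ℤ_[p] (W.tateModule p) := TateModule.continuousSMul_padicInt
  haveI : Module.Free ℤ_[p] (W.tateModule p) := W.module_free_tateModule_holds p
  haveI : Module.Finite ℤ_[p] (W.tateModule p) := W.module_finite_tateModule_holds p
  obtain ⟨⟨κ, hκ, γ, hγ, I, z₀, hadm⟩, -⟩ := hKMC Fact.out
  have hz₀ : z₀ ≠ 0 := hadm.ne_zero_of_rohrlich hγ (fun hf ↦ rohrlich_primePow_of_isNewformOf hf)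
  obtain ⟨hfin, ⟨htf, hrk⟩, -⟩ := h12 W p κ γ hκ hγ I
  let v : HeightOneSpectrum (𝓞 ℚ) := Rat.HeightOneSpectrum.primesEquiv.symm ⟨p, Fact.out⟩
  have hv : ((Rat.HeightOneSpectrum.primesEquiv v : Nat.Primes) : ℕ) = p := by
    simp only [v, Equiv.apply_symm_apply]
  obtain ⟨J, hJ⟩ := ContraBridge.exists_iwasawaH2Data_lengthAt_eq_forall_fineSelmerDualData_inv hH2 hγ v hp hκ
    hv (hloc κ v hκ hv) I
  obtain ⟨D, hD, -⟩ :=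
    exists_isKatoZetaDescentDatumOfContra_of_packages W p hκ hγ I hfin htf hrk J hJ hz₀ hadm
  exact ⟨D, hD⟩

/-! ## §3 Stub 4 by name -/

/-- **STUB 4 `stub_realizableOfKMCFine` of the Kato–Perrin-Riou skeletons v4, REDUCED:**
`TorsionFree.RealizableOfKMC IsKatoZetaDescentDatumOfContra KatoMainConjectureFineContra` follows from
`Kato2004.thm12_4`, `Kato2004.exists_iwasawaH2Data_fineSelmerDual_embedding` and the displayed schema «`W`
potentially good at `p` (`0 ≤ v_p(j W)`) ⟹ `W(ℚ_{p,∞})[p^∞]` finite for the cyclotomic `κ` and the place `v | p`»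
— Imai's theorem over a field of good reduction (NOT proved here). The schema's `Addv W p` and `¬ p ∣ W.torsionOrder`
are not used. CONDITIONAL reduction; closes no stub; nothing asserted on 19945 / 19223; BSD is not proved for any
curve. [cite: Kato2004Asterisque, Thm. 12.4 (p. 221), Thm. 12.5 (1) (pp. 221–222), Conj. 12.10 (p. 224), (14.9.1) (p. 239), §14.14 (14.14.1) (p. 243)]
[cite: Imai1975, Theorem (p. 12)] [cite: SilvermanAEC2009, Prop. VII.5.5] [cite: RohrlichInventiones1984, Theorem (p. 409)] -/
theorem realizableOfKMC_contra_of_thm12_4_of_h2Embedding_of_localFinite (h12 : Kato2004.thm12_4)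
    (hH2 : Kato2004.exists_iwasawaH2Data_fineSelmerDual_embedding)
    (hImai : ∀ (W : WeierstrassCurve ℚ) [W.IsElliptic] (p : ℕ) [Fact p.Prime] (κ : ZpExtension ℚ p)
      (v : HeightOneSpectrum (𝓞 ℚ)), 0 ≤ padicValRat p W.j → κ.IsCyclotomic →
      ((Rat.HeightOneSpectrum.primesEquiv v : Nat.Primes) : ℕ) = p →
      Finite (FixedPoints.addSubgroup ↥(κ.kerSubgroup ⊓ GreenbergSelmer.decomp v) (W.geomPrimaryTorsion p))) :
    TorsionFree.RealizableOfKMC IsKatoZetaDescentDatumOfContra KatoMainConjectureFineContra := by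
  intro W _ _ p _ hp _ hj _ hKMC
  exact exists_isKatoZetaDescentDatumOfContra_of_kmcFineContra h12 hH2 W p hp
    (fun κ v hκ hv ↦ hImai W p κ v hj hκ hv) hKMC

end Summit.BirchSwinnertonDyer.Rank1Residual.Additive.ContraRealizable

end
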